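import Summits.CriticalPhenomena.PercolationContinuityZ3.Theorems.PercNearOneGluingNoHeavyQuantGluedWindowNearH
import Summits.CriticalPhenomena.PercolationContinuityZ3.Theorems.PercNearOneGluingNoHeavyQuantGluedWindowFarFit
import Summits.CriticalPhenomena.PercolationContinuityZ3.Theorems.PercNearOneGluingNoHeavyQuantGluedWindowLightPair
import HarnessLib

/-!
# QUANT lane R8, T-DEC: LEMMA W's pair condition — ASSEMBLY of the two-row h-mid regime with the TOP COPY REACHABLE and the middle copy fitting into it:
# `T < 2l + r + k` and (middle copy light for the top copy, or `q(1−g)(T−2l−2r) ≤ qg(2l+2r+k−T)`) ⟹ the pair condition, whatever the status of `(l, h)` at `T`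
# — `…_lightPair` ∪ `…_nearH` ∪ `…_farFit` (arm-1 gen 61, architect)

builds on p205010 (kernel theorem, internal audit signed; external expert review pending)

Support file (`--supports stmt-CriticalPhenomena-4575`), QUANT lane seat prim-quant-arm-1 (gen 61, architect); memo
`run/shared/lean/prim/quant/prim-quant-arm-1-g61/ARCH-G61.md` §7.  Theorems only; standard axioms, no sorries, no definitions.

THE THEOREM **`gluedPullback_windowPair_twoRow_topFit`**: band frame and price system of `gluedPullback_windowPair_of_lemmaW`; light window pair `(l, h)` below a
cheap atom `c ≥ h`; two-row regime, `h` a mid; `T < 2l + r + k`; the middle copy fits into the top copy ⟹ `(1−γ)Ψ(l) + γΨ(h) ≤ 0`.  Case split on `T − 2l`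
against `y(h−l)` (→ `…_lightPair`, p628216; no fit hypothesis needed there), `h − l` (→ `…_nearH`, p634954) and beyond (→ `…_farFit`, p635506).  With
`…_twoRow_poolOnly` (arm-1 g59) and `…_farH` (p632451) this leaves, in the h-mid half of the two-row regime, only: the top copy unreachable with
`y(h−l) < T − 2l < h − l + r`, and the non-fitting heavy middle copy with `T − 2l < h − l + r` (≈ 4 % of the h-mid configurations in the scale-free census, memo §7).

HONEST STATUS.  `GluedLemmaW` (flow form), `GluedDominatedMass`, the band, `SiblingStep`, `FarTreeRow` OPEN; RATE class (log\*) / honest sentence of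
`run/shared/lean/prim/quant/README.md` unchanged.  [this work].  Nothing here is cited as a published result.  The gluing rows served
[cite: KozmaNitzan2024, Conjecture 3 (p. 15)]; product measure [cite: Grimmett1999, §1.3 p. 10].
-/

noncomputable section

namespace Summit.CriticalPhenomena.PercolationContinuityZ3.Theorems
namespace Quant
namespace LawDec

/-- **LEMMA W's PAIR CONDITION IN THE TWO-ROW h-MID REGIME WHEN THE TOP COPY IS REACHABLE AND THE MIDDLE COPY FITS INTO IT** (`T < 2l + r + k`; middle
copy light for the top copy or `q(1−g)(T−2l−2r) ≤ qg(2l+2r+k−T)`): no hypothesis on the status of `(l, h)` at the glued target. [this work] -/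
theorem gluedPullback_windowPair_twoRow_topFit (x a q g S : ℝ) (B r k j l h c ls : ℕ) (α p : ℕ → ℝ)
    (hx0 : 0 < x) (hx1 : x < 1) (ha0 : 0 < a) (ha1 : a ≤ 1) (hq0 : 0 < q) (hq1 : q < 1) (hg0 : 0 ≤ g) (hg1 : g ≤ 1) (hr : 1 ≤ r) (hk : 1 ≤ k)
    (hxqg : x ≤ q * g)
    (hlh : l < h) (hhB : h ≤ B) (hhj : h ≤ j) (hwin : j < h + r + k) (hlow : 2 * (l : ℝ) < a * S) (hcomp : a * S < (l : ℝ) + h)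
    (hlight : pairGate (a * x) (a * S) l h < a * x)
    (hL2j : l + r + k ≤ j) (hL2mid : a * (S + q * ((r : ℝ) + k * g)) ≤ 2 * ((l : ℝ) + r + k))
    (hL1low : 2 * ((l : ℝ) + r) < a * (S + q * ((r : ℝ) + k * g))) (hhmid : a * (S + q * ((r : ℝ) + k * g)) ≤ 2 * (h : ℝ))
    (hAcomp : a * (S + q * ((r : ℝ) + k * g)) < 2 * (l : ℝ) + r + k)
    (hcase : a * (S + q * ((r : ℝ) + k * g)) - 2 * ((l : ℝ) + r) ≤ (a * x) * (k : ℝ) ∨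
      q * (1 - g) * (a * (S + q * ((r : ℝ) + k * g)) - 2 * ((l : ℝ) + r)) ≤ q * g * (2 * ((l : ℝ) + r) + k - a * (S + q * ((r : ℝ) + k * g))))
    (hhc : h ≤ c) (hcB : c ≤ B) (hcj : c ≤ j)
    (hp : ∀ h, 0 ≤ p h)
    (hαp : ∀ l' h', l' ≤ j → 2 * (l' : ℝ) < a * (S + q * ((r : ℝ) + k * g)) → h' ≤ B + (r + k) →
      (j + 1 ≤ h' ∨ a * (S + q * ((r : ℝ) + k * g)) < (l' : ℝ) + h') →
      α l' ≤ usage (a * x) (a * (S + q * ((r : ℝ) + k * g))) j l' h' * p h')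
    (hcheap : -(gluedPullback (a * (S + q * ((r : ℝ) + k * g))) q g j r k α p c) * (a * x)
      < (1 - a * x) * gluedPullback (a * (S + q * ((r : ℝ) + k * g))) q g j r k α p ls) :
    (1 - pairGate (a * x) (a * S) l h) * gluedPullback (a * (S + q * ((r : ℝ) + k * g))) q g j r k α p l
      + pairGate (a * x) (a * S) l h * gluedPullback (a * (S + q * ((r : ℝ) + k * g))) q g j r k α p h ≤ 0 := by
  by_cases hlightT : a * (S + q * ((r : ℝ) + k * g)) - 2 * (l : ℝ) ≤ (a * x) * ((h : ℝ) - l)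
  · exact gluedPullback_windowPair_twoRow_lightPair x a q g S B r k j l h c ls α p hx0 hx1 ha0 ha1 hq0 hq1 hg0 hg1 hr hk hxqg hlh hhB hhj hwin
      hlow hcomp hlight hL2j hL2mid hL1low hhmid hlightT hhc hcB hcj hp hαp hcheap
  have hheavyT : (a * x) * ((h : ℝ) - l) ≤ a * (S + q * ((r : ℝ) + k * g)) - 2 * (l : ℝ) := (lt_of_not_ge hlightT).le
  by_cases hcompT : a * (S + q * ((r : ℝ) + k * g)) < (l : ℝ) + h
  · exact gluedPullback_windowPair_twoRow_nearH x a q g S B r k j l h c ls α p hx0 hx1 ha0 ha1 hq0 hq1 hg0 hg1 hr hk hxqg hlh hhB hhj hwin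
      hlow hcomp hlight hL2j hL2mid hL1low hhmid hAcomp hheavyT hcompT hcase hhc hcB hcj hp hαp hcheap
  · exact gluedPullback_windowPair_twoRow_farFit x a q g S B r k j l h c ls α p hx0 hx1 ha0 ha1 hq0 hq1 hg0 hg1 hr hk hxqg hlh hhB hwin
      hlow hcomp hlight hL2j hL2mid hL1low hhmid hAcomp (le_of_not_gt hcompT) hcase hhc hcB hcj hp hαp hcheap

end LawDec
end Quant
end Summit.CriticalPhenomena.PercolationContinuityZ3.Theorems
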